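import Literature.AnabelianGeometry.SemiGraphs.TemperedReconstructionEdgeMapProofs
import Literature.AnabelianGeometry.SemiGraphs.TemperedCompactInVerticialAt
import HarnessLib

/-!
# Semi-graphs of anabelioids, §3: Corollary 3.9 — the edge map of a quasi-geometric morphism, AT ONE PAIR OF GRAPHS

Mochizuki, *Semi-graphs of anabelioids*, Publ. RIMS **42** (2006), §3, Corollary 3.9, proof, manuscript
p. 42 [cite: MochizukiSemiAnbd2006, Cor 3.9 p.42]: "Similarly, by considering nontrivial intersections
of maximal compact subgroups, one obtains … a map from the edges of `G` to the edges of `H` which is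
compatible with the map obtained above on vertices."

PROOF-ONLY companion (abc-iut cell, L3-lead ruling α4-3 «φ2-CONSUMERS», block B0c, seat abc-iut-L3-d1)
of `TemperedReconstructionEdgeMapProofs.lean` (abc-iut-L3-t2): the SAME proofs of
`edge_eq_of_mapsOnto_of_le`, `exists_edge_mapsOnto_of_isQuasiGeometric`,
`existsUnique_edgeMap_of_isQuasiGeometric`, with the ∀-countable named facts
`MaximalCompactIffVerticial` (Thm. 3.7 (iv)) and `EdgeLikeDistinct` (the edge form of Thm. 3.7 (ii))
replaced by their per-graph forms `MaximalCompactIffVerticialAt`, `EdgeLikeDistinctAt`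
(`TemperedCompactInVerticialAt.lean`, abc-iut-w4-d075) at the graphs where each proof instantiates
them (`MaximalCompactIffVerticialAt` at `𝒢` and at `ℋ`; `EdgeLikeDistinctAt` at `ℋ` only).  Port rule
(α4-3): `hX X hX c ↦ hXAt hX c`, decl suffix `_at`; everything else verbatim; the original is untouched
(its fact-free lemmas `isClosedEdge_of_isGraph`, `exists_mem_edgeLikeSubgroups_ne_bot` are reused by
name).  Nothing here takes a side on [IUTchIII] Cor. 3.12; typed ≠ discharged.
-/

open CategoryTheory Topology

namespace Literature.AnabelianGeometry.SemiGraphs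

namespace ProfiniteSemiGraph

universe u

variable {𝒢 ℋ : ProfiniteSemiGraph.{u}}

/-- **The edge is determined, from `EdgeLikeDistinct` AT `ℋ`**: if `φ` maps `L` onto an open subgroup
of an edge-like subgroup `L₂` at `e`, and `φ(L)` also lies in an edge-like subgroup `L₂'` at `e'`, then
`e = e'` (φ2-consumers twin of `edge_eq_of_mapsOnto_of_le`). [cite: MochizukiSemiAnbd2006, Cor 3.9 p.42] -/
theorem edge_eq_of_mapsOnto_of_le_at (hED : EdgeLikeDistinctAt ℋ) (hℋ : ℋ.Thm37Hypotheses)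
    {P : Type u} [Group P] (cℋ : TemperedPiChart ℋ) (φ : P →* cℋ.G) {L : Subgroup P}
    {e e' : ℋ.graph.Edge} {L₂ L₂' : Subgroup cℋ.G} (hL₂ : L₂ ∈ edgeLikeSubgroups cℋ e)
    (hL₂' : L₂' ∈ edgeLikeSubgroups cℋ e') (hmaps : MapsOntoOpenSubgroupOf φ L L₂)
    (hle : L.map φ ≤ L₂') : e = e' := by
  have h1 : (L.map φ).relIndex L₂ ≠ 0 :=
    relIndex_ne_zero_of_mapsOnto φ (isCompact_of_mem_edgeLikeSubgroups cℋ hL₂) hmaps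
  have h2 : L₂'.relIndex L₂ ≠ 0 := fun h0 => h1 (Subgroup.relIndex_eq_zero_of_le_left hle h0)
  by_contra hne
  exact h2 (hED hℋ cℋ e e' L₂ L₂' hL₂ hL₂' hne)

/-- The image, under a quasi-geometric `φ`, of a nontrivial edge-like subgroup of a (closed) edge lies,
as an open subgroup, in an edge-like subgroup of a closed edge of `H` — from Def. 3.8 and Thm. 3.7 (iv)
AT `𝒢` and AT `ℋ` (φ2-consumers twin of `exists_edge_mapsOnto_of_isQuasiGeometric`).
[cite: MochizukiSemiAnbd2006, Cor 3.9 p.42] -/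
theorem exists_edge_mapsOnto_of_isQuasiGeometric_at (h37iv𝒢 : MaximalCompactIffVerticialAt 𝒢)
    (h37ivℋ : MaximalCompactIffVerticialAt ℋ)
    (h𝒢 : Cor39Hypotheses 𝒢) (hℋ : Cor39Hypotheses ℋ) (c𝒢 : TemperedPiChart 𝒢) (cℋ : TemperedPiChart ℋ)
    {φ : c𝒢.G →ₜ* cℋ.G} (hφ : IsQuasiGeometric φ) {e : 𝒢.graph.Edge} {L : Subgroup c𝒢.G}
    (hL : L ∈ edgeLikeSubgroups c𝒢 e) (hL0 : L ≠ ⊥) :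
    ∃ (e' : ℋ.graph.Edge) (L₂ : Subgroup cℋ.G), L₂ ∈ edgeLikeSubgroups cℋ e' ∧
      MapsOntoOpenSubgroupOf φ.toMonoidHom L L₂ := by
  obtain ⟨-, hint𝒢⟩ := h37iv𝒢 h𝒢.thm37Hypotheses c𝒢
  obtain ⟨-, hintℋ⟩ := h37ivℋ hℋ.thm37Hypotheses cℋ
  obtain ⟨K₁, H₁, hK₁, hH₁, hne, rfl⟩ :=
    (hint𝒢 L hL0).mpr ⟨e, isClosedEdge_of_isGraph h𝒢.isGraph e, hL⟩
  obtain ⟨K₂, H₂, hK₂, hH₂, hne₂, hnt₂, hmaps⟩ := hφ.inter K₁ H₁ hK₁ hH₁ hne hL0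
  obtain ⟨e', -, hL₂⟩ := (hintℋ (K₂ ⊓ H₂) hnt₂).mp ⟨K₂, H₂, hK₂, hH₂, hne₂, rfl⟩
  exact ⟨e', K₂ ⊓ H₂, hL₂, hmaps⟩

/-- **A quasi-geometric `φ` determines the map on edges, from Thm. 3.7 (iv) AT `𝒢`, `ℋ` and
`EdgeLikeDistinct` AT `ℋ`** ([SemiAnbd] Cor. 3.9, proof, p. 42), with Thm. 3.7 (i): for graphs `G`, `H` as
in Cor. 3.9 there is a unique `f_E : E(G) → E(H)` such that every edge-like subgroup of `π₁^temp(G)` at `e`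
maps onto an open subgroup of some edge-like subgroup of `π₁^temp(H)` at `f_E(e)` (φ2-consumers twin of
`existsUnique_edgeMap_of_isQuasiGeometric`). [cite: MochizukiSemiAnbd2006, Cor 3.9 p.42] -/
theorem existsUnique_edgeMap_of_isQuasiGeometric_at (h37i : VerticialInjective.{u})
    (h37iv𝒢 : MaximalCompactIffVerticialAt 𝒢) (h37ivℋ : MaximalCompactIffVerticialAt ℋ)
    (hED : EdgeLikeDistinctAt ℋ)
    (h𝒢 : Cor39Hypotheses 𝒢) (hℋ : Cor39Hypotheses ℋ) (c𝒢 : TemperedPiChart 𝒢)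
    (cℋ : TemperedPiChart ℋ) (φ : c𝒢.G →ₜ* cℋ.G) (hφ : IsQuasiGeometric φ) :
    ∃! fE : 𝒢.graph.Edge → ℋ.graph.Edge,
      ∀ (e : 𝒢.graph.Edge) (L : Subgroup c𝒢.G), L ∈ edgeLikeSubgroups c𝒢 e →
        ∃ L₂ ∈ edgeLikeSubgroups cℋ (fE e), MapsOntoOpenSubgroupOf φ.toMonoidHom L L₂ := by
  -- choose, for each edge, a nontrivial edge-like subgroup and the edge of its image
  choose L₀ hL₀ hL₀0 using fun e => exists_mem_edgeLikeSubgroups_ne_bot h37i h𝒢 c𝒢 e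
  choose fE L₂ hL₂ hmaps using fun e =>
    exists_edge_mapsOnto_of_isQuasiGeometric_at h37iv𝒢 h37ivℋ h𝒢 hℋ c𝒢 cℋ hφ (hL₀ e) (hL₀0 e)
  -- any edge-like subgroup at `e` goes to the same edge
  have hall : ∀ (e : 𝒢.graph.Edge) (L : Subgroup c𝒢.G), L ∈ edgeLikeSubgroups c𝒢 e →
      ∃ L₂' ∈ edgeLikeSubgroups cℋ (fE e), MapsOntoOpenSubgroupOf φ.toMonoidHom L L₂' := by
    intro e L hL
    obtain ⟨g, rfl⟩ := exists_conj_of_mem_edgeLikeSubgroups c𝒢 (hL₀ e) hL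
    have hL0 : (L₀ e).map (MulAut.conj g).toMonoidHom ≠ ⊥ := fun h0 =>
      hL₀0 e ((Subgroup.map_eq_bot_iff_of_injective _ (MulAut.conj g).injective).mp h0)
    obtain ⟨e', L₂', hL₂', hmaps'⟩ :=
      exists_edge_mapsOnto_of_isQuasiGeometric_at h37iv𝒢 h37ivℋ h𝒢 hℋ c𝒢 cℋ hφ hL hL0
    have hle : ((L₀ e).map (MulAut.conj g).toMonoidHom).map φ.toMonoidHom ≤
        (L₂ e).map (MulAut.conj (φ g)).toMonoidHom := by
      rintro _ ⟨_, ⟨k, hk, rfl⟩, rfl⟩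
      refine ⟨φ k, (hmaps e).1 ⟨k, hk, rfl⟩, ?_⟩
      change φ g * φ k * (φ g)⁻¹ = φ (g * k * g⁻¹)
      rw [map_mul, map_mul, map_inv]
    have he : e' = fE e :=
      edge_eq_of_mapsOnto_of_le_at hED hℋ.thm37Hypotheses cℋ φ.toMonoidHom hL₂'
        (conj_mem_edgeLikeSubgroups' cℋ (hL₂ e) (φ g)) hmaps' hle
    subst he
    exact ⟨L₂', hL₂', hmaps'⟩
  refine ⟨fE, hall, fun fE' hfE' => funext fun e => ?_⟩
  obtain ⟨L₂', hL₂', hmaps'⟩ := hfE' e (L₀ e) (hL₀ e)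
  exact edge_eq_of_mapsOnto_of_le_at hED hℋ.thm37Hypotheses cℋ φ.toMonoidHom hL₂' (hL₂ e) hmaps'
    (hmaps e).1

end ProfiniteSemiGraph

end Literature.AnabelianGeometry.SemiGraphs
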